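import Summits.ValiantsHypothesis.ValiantsHypothesis.Theorems.DivisionGapPerDivisionHardStubIsolationRigid
import Summits.ValiantsHypothesis.ValiantsHypothesis.Theorems.DivisionGapPerDivisionHardStubTopTransfer
import Summits.ValiantsHypothesis.ValiantsHypothesis.Theorems.DivisionGapPerDivisionHardKeys

/-!
# Crux `DivisionGap.PerDivisionHard` (stmt-ValiantsHypothesis-5065), line `pair-descent-jss-endpoint` —
the ISOLATION rung (skeleton v15.2, chapter RIGID CELLS, part E): magnets as a class

`PerDivisionHard` asks: for every `c`, for all large `n`, every nonzero `h ∈ ℝ≥0[x_ij]` has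
`2^{(log₂ n + c)^c} < L(per_n · h) + L(h)`.  The generic cut of the line is `W` on the placed face and
`W - B^{rank e}` off it; its top fibre consists of the monomials whose off-face exponent vector is
LEXICOGRAPHICALLY MINIMAL in rank order — and the rank order is the prover's (dossier v8: "the digit
ORDER magnetises").  Call `m* ∈ supp h` ISOLATED by the cells `e 0, …, e (t-1)` if every other
monomial of `h` is lexicographically larger along that list, i.e. the iterated coordinate-argmin over
the list ends in `{m*}`.  This file proves, UNCONDITIONALLY:

* `perDivisionHard_isolation` — if all monomials of `h ≠ 0` have one degree (e.g. `h` torus-homogeneous)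
  and some monomial is isolated by `t ≤ n/4` cells, then `2^{(log₂ n+c)^c} < L(per_n·h) + L(h)`;
* `perDivisionHard_isolationTop` — the same for ANY `h ≠ 0` whose TOP-DEGREE part has a monomial
  isolated inside it (the top-degree part is free on both sides of the pair: `stub_topTransfer` with
  the constant torus character);
* `perDivisionHard_uniqueArgmin` — the one-cell case: some cell's minimal exponent over the (one-degree)
  support is attained by exactly one monomial.

Mechanism: face off the isolating cells (`stub_keyPlacement`), ordered generic cut with those cells at
the top ranks (`stub_orderedCut`), so the fibre is `{m*}` (`stub_isolationRigid`); then the common tail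
`two_pow_lt_of_rigid` (face descent, JSS contraction, arsenal).  No torus homogeneity, no counting, no
prices.  CONTAINS: the JSS monomial rung (`t = 0`), the key rung of `…Keys.lean` (any order on a key
isolates every monomial), and — with ONE cell — the free-default adversary
`h_bal = ∏_{i≠ρ₀}(Σ_j x_ij ∏_{j'≠j} x_{ρ₀ j'})` of dossier v6 (minimising the exponent of `(ρ₀, j₁)`
maximises the number of rows choosing column `j₁`, uniquely at the constant choice).  Residual: for
every list of `≤ n/4` cells the iterated coordinate-argmin of the top-degree part of an undecided
cofactor keeps at least two monomials.
-/

noncomputable section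

-- `Summit.ValiantsHypothesis.ValiantsHypothesis.…` is the tree's mandated single-conjunct layout
-- (Sub = Summit), so the duplicated namespace component is intended.
set_option linter.dupNamespace false

namespace Summit.ValiantsHypothesis.ValiantsHypothesis.Theorems.DivisionGapPerDivisionHard

open MvPolynomial Literature.Computability.AlgebraicComplexity
open Summit.ValiantsHypothesis.ValiantsHypothesis.Theorems.ZeroOneTransfer.Negative
  (topComponent topComponent_ne_zero coeff_topComponent)
open scoped NNReal

/-- **The ISOLATION rung of `PerDivisionHard`, one-degree form.**  For every `c` there is `n₀` such
that for all `n ≥ n₀` and every nonzero `h` all of whose monomials have the same degree: if some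
monomial `ms` of `h` is isolated by an injective list `e` of `t` cells with `4t ≤ n` (every other
monomial of `h` is lexicographically larger along `e`), then `2^{(log₂ n+c)^c} < L(per_n·h) + L(h)`. -/
theorem perDivisionHard_isolation :
    ∀ c : ℕ, ∃ n₀ : ℕ, ∀ n ≥ n₀, ∀ h : MvPolynomial (Fin n × Fin n) ℝ≥0, h ≠ 0 →
      (∀ m₁ ∈ h.support, ∀ m₂ ∈ h.support, m₁.degree = m₂.degree) →
      ∀ (t : ℕ) (e : Fin t → Fin n × Fin n), Function.Injective e → 4 * t ≤ n →
      ∀ ms ∈ h.support,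
      (∀ m' ∈ h.support, m' ≠ ms →
        ∃ i : Fin t, (∀ j : Fin t, j < i → m' (e j) = ms (e j)) ∧ ms (e i) < m' (e i)) →
      2 ^ ((Nat.log 2 n + c) ^ c) < complexity (perPoly (Fin n) ℝ≥0 * h) + complexity h := by
  intro c
  obtain ⟨κ, hcon⟩ := stub_jssContraction
  obtain ⟨d, n₁, hhard⟩ := stub_blockArsenal c κ
  obtain ⟨n₀, hS⟩ := stub_isolationRigid d
  refine ⟨n₀ + n₁, fun n hn h hh hdeg t e he ht ms hms hiso => ?_⟩
  obtain ⟨b, k, m, eR, eC, w, u, hb, hcut, hsingle⟩ := hS n (by omega) h hh hdeg t e he ht ms hms hiso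
  exact two_pow_lt_of_rigid c κ d n₁ n hcon hhard (by omega) hh le_rfl eR eC w u hb hcut hsingle

/-- Monomials of a top component for the constant character all have the top degree. [folklore] -/
theorem degree_eq_of_mem_support_topComponent_one {n : ℕ} (h : MvPolynomial (Fin n × Fin n) ℝ≥0)
    {m₁ m₂ : (Fin n × Fin n) →₀ ℕ}
    (hm₁ : m₁ ∈ (topComponent (fun e : Fin n × Fin n => (fun _ : Fin n => 1) e.1 + (fun _ : Fin n => 0) e.2) h).support)
    (hm₂ : m₂ ∈ (topComponent (fun e : Fin n × Fin n => (fun _ : Fin n => 1) e.1 + (fun _ : Fin n => 0) e.2) h).support) :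
    m₁.degree = m₂.degree := by
  set w : Fin n × Fin n → ℕ := fun e => (fun _ : Fin n => 1) e.1 + (fun _ : Fin n => 0) e.2 with hw
  have hw1 : w = fun _ => 1 := by funext x; simp [hw]
  have hwt : ∀ mm : (Fin n × Fin n) →₀ ℕ, Finsupp.weight w mm = mm.degree := by
    intro mm
    rw [hw1, Finsupp.degree_eq_weight_one]
  have key : ∀ mm ∈ (topComponent w h).support, Finsupp.weight w mm = weightedTotalDegree w h := by
    intro mm hmm
    have := mem_support_iff.mp hmm
    rw [coeff_topComponent] at this
    by_contra hne'
    exact this (if_neg hne')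
  rw [← hwt m₁, ← hwt m₂, key m₁ hm₁, key m₂ hm₂]

/-- **The ISOLATION rung of `PerDivisionHard`, general form.**  For every `c` there is `n₀` such that
for all `n ≥ n₀` and every nonzero `h`: if some monomial of the TOP-DEGREE part `h₁ = top_w h`
(`w` the constant character `1 + 0`) is isolated inside `supp h₁` by an injective list of `t` cells
with `4t ≤ n`, then `2^{(log₂ n+c)^c} < L(per_n·h) + L(h)` (`stub_topTransfer`: `h₁` costs nothing
on either side; `perDivisionHard_isolation` for `h₁`). -/
theorem perDivisionHard_isolationTop :
    ∀ c : ℕ, ∃ n₀ : ℕ, ∀ n ≥ n₀, ∀ h : MvPolynomial (Fin n × Fin n) ℝ≥0, h ≠ 0 →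
      ∀ (t : ℕ) (e : Fin t → Fin n × Fin n), Function.Injective e → 4 * t ≤ n →
      ∀ ms ∈ (topComponent (fun e : Fin n × Fin n => (fun _ : Fin n => 1) e.1 + (fun _ : Fin n => 0) e.2) h).support,
      (∀ m' ∈ (topComponent (fun e : Fin n × Fin n => (fun _ : Fin n => 1) e.1 + (fun _ : Fin n => 0) e.2) h).support,
        m' ≠ ms → ∃ i : Fin t, (∀ j : Fin t, j < i → m' (e j) = ms (e j)) ∧ ms (e i) < m' (e i)) →
      2 ^ ((Nat.log 2 n + c) ^ c) < complexity (perPoly (Fin n) ℝ≥0 * h) + complexity h := by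
  intro c
  obtain ⟨n₀, hI⟩ := perDivisionHard_isolation c
  refine ⟨n₀, fun n hn h hh t e he ht ms hms hiso => ?_⟩
  obtain ⟨hle1, hle2⟩ := stub_topTransfer n (fun _ => 1) (fun _ => 0) h
  exact lt_of_lt_of_le (hI n hn _ (topComponent_ne_zero _ hh)
    (fun m₁ hm₁ m₂ hm₂ => degree_eq_of_mem_support_topComponent_one h hm₁ hm₂) t e he ht ms hms hiso)
    (Nat.add_le_add hle1 hle2)

/-- **The UNIQUE-ARGMIN rung (one-cell isolation).**  For every `c` there is `n₀` such that for all
`n ≥ n₀` (`n ≥ 4`) and every nonzero `h` all of whose monomials have the same degree: if for some cell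
`e₀` the minimal exponent of `e₀` over `supp h` is attained by exactly one monomial `ms`, then
`2^{(log₂ n+c)^c} < L(per_n·h) + L(h)`.  Example: the free-default product
`h_bal = ∏_{i≠ρ₀}(Σ_j x_ij ∏_{j'≠j} x_{ρ₀ j'})` with `e₀ = (ρ₀, j₁)`. -/
theorem perDivisionHard_uniqueArgmin :
    ∀ c : ℕ, ∃ n₀ : ℕ, ∀ n ≥ n₀, ∀ h : MvPolynomial (Fin n × Fin n) ℝ≥0, h ≠ 0 →
      (∀ m₁ ∈ h.support, ∀ m₂ ∈ h.support, m₁.degree = m₂.degree) →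
      ∀ (e₀ : Fin n × Fin n), ∀ ms ∈ h.support, (∀ m' ∈ h.support, m' ≠ ms → ms e₀ < m' e₀) →
      2 ^ ((Nat.log 2 n + c) ^ c) < complexity (perPoly (Fin n) ℝ≥0 * h) + complexity h := by
  intro c
  obtain ⟨n₀, hI⟩ := perDivisionHard_isolation c
  refine ⟨n₀ + 4, fun n hn h hh hdeg e₀ ms hms hmin => ?_⟩
  refine hI n (by omega) h hh hdeg 1 (fun _ => e₀) (fun i j _ => Subsingleton.elim i j) (by omega)
    ms hms fun m' hm' hne => ⟨0, fun j hj => absurd hj (by simp), hmin m' hm' hne⟩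

end Summit.ValiantsHypothesis.ValiantsHypothesis.Theorems.DivisionGapPerDivisionHard

end
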